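import Mathlib.Analysis.Analytic.Basic
import Mathlib.Analysis.Analytic.Constructions
import Mathlib.Analysis.Calculus.FDeriv.Analytic
import Mathlib.Analysis.Calculus.Deriv.Mul
import Mathlib.Analysis.Calculus.Deriv.Comp
import Mathlib.Analysis.Calculus.Deriv.Pow
import Literature.MathematicalPhysics.KineticTheory.HardSphereEulerLocalTheory
import Literature.Analysis.FluidPDE.ClassicalEulerPointData
import HarnessLib

/-!
# Local theory of the hard-sphere compressible Euler system on `𝕋³`: proofs — Step 0
(the equation of state at small packing) and Step 5 (from the symmetric form to the
conservation form)

MathematicalPhysics/KineticTheory proof file (theorems only; no definitions, no named facts),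
sibling of `HardSphereEulerLocalTheory.lean`, whose named fact `hsEuler_localExistence`
(Dafermos 2005, Ch. V §5.1, Thm 5.1.1, existence clause, rendered for the `5 × 5` hard-sphere
Euler system `IsHardSphereEulerSolution σ T ρ u θ` on `𝕋³`) is to be discharged here as
`hsEuler_localExistence_holds`.

## Architecture of the printed proof (Dafermos 2005, pp. 122–125 of the held text) and status

Thm 5.1.1 is proved for a system of conservation laws `∂ₜU + ∑_α ∂_α G_α(U) = 0` on `ℝ^m`
endowed with an entropy `η` with `D²η` positive definite uniformly on compact subsets of the
state domain `𝒪`, i.e. (Dafermos (4.3.2), §5.4; Majda 1984, Ch. 2 §2.1; Taylor, *PDE III*,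
Ch. 16 §2) for a *symmetrisable* quasilinear hyperbolic system with smooth coefficients:

* Step 0 (scope). The concrete system is smooth and symmetrisable on the relevant state
  domain, and the data take values in a compact subset of it. **Proved in this file** for the
  hard-sphere system: under the equation-of-state hypothesis of the fact (`hsExcessFreeEnergy`
  agrees on `[0, η₀)` with `F` analytic on `(-η₀, η₀)`) the compressibility factor is
  `Z(η) = 1 + ηF'(η)` on `(0, η₀)` and is real analytic there (`hsCompressibility_eq`,
  `analyticOnNhd_hsCompressibility`); the pressure law `p = hsPressure σ ρ θ = ρθZ(ρσ³)` is
  jointly real analytic, hence `C^∞`, on the open state set `{0 < ρσ³ < η₀}`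
  (`analyticOnNhd_hsPressure`, `contDiffOn_hsPressure`); `∂p/∂ρ = θ(Z + ηZ')(ρσ³) =
  θ(1 + 2ηF' + η²F'')(ρσ³)` (`hasDerivAt_hsPressure_density`); and there is a packing threshold
  `η_c ∈ (0, η₀)`, depending only on `(η₀, F)`, with `1 + 2ηF' + η²F'' ≥ 1/2` on `[-η_c, η_c]`
  (`exists_packing_threshold`), so that `∂p/∂ρ ≥ θ/2 > 0` for `θ > 0` and `0 < ρσ³ ≤ η_c`
  (`deriv_hsPressure_density_ge`, `exists_threshold_deriv_hsPressure_density_ge`). This is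
  exactly the positivity of the Friedrichs symmetriser `diag(p_ρ/ρ, ρ, ρ, ρ, 3ρ/(2θ))` of the
  system in the variables `(ρ, u, θ)` (equivalently the uniform convexity of the entropy
  `-ρs`, `s = (3/2) log θ - log ρ - F(ρσ³)`), and the origin of the quantifier `∃ η₁` placed
  before `∀ σ` in the fact (`η₁ = η_c / 2`). Finally, continuous positive data on the compact
  torus are pinched between positive constants (`exists_pos_le_le_of_continuous`), i.e. take
  values in a compact subset of the state domain, as Thm 5.1.1 requires.
* Step 1 (linear theory). Existence for the linearised symmetrisable system (5.1.10) with
  mollified coefficients — "the classical theory of symmetrizable linear hyperbolic systems"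
  (tree, whole space `ℝⁿ`: `Literature.Analysis.PDE.SymmetricHyperbolicExistence`,
  `exists_smooth_solution`, Friedrichs 1954). OPEN on `𝕋³`.
* Step 2 (high-norm bounds). The commutator/Moser estimate (5.1.12) and the `D²η`-weighted
  energy inequality (5.1.13)–(5.1.17): the iteration map preserves the ball (5.1.6)–(5.1.7) for
  `ω` large and `T` small. OPEN (tree analogues: the `Hᵐ` energy method for the regularised
  quasilinear flow on `ℝᵈ`, `Literature/Barriers/AtomisticToContinuum/NoBVEstimatesMultiD*`,
  small data only; the Fourier–Galerkin `Hᵐ` method on `𝕋ᵈ` for incompressible flows,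
  `Literature.Analysis.FluidPDE.GalerkinSmoothHm` … `GalerkinSmoothSolution`).
* Step 3 (contraction in the low norm (5.1.18)–(5.1.23), fixed point, regularity (5.1.3)). OPEN.
* Step 4 (`C^∞` solutions for `C^∞` data: the `H^ℓ` life span does not depend on `ℓ`, by the
  linear Grönwall inequality (5.1.25); time derivatives from the equation). OPEN.
* Step 5 (assembly). **Proved in this file**: (5a) smooth positive fields satisfying the
  PRIMITIVE (convective) equations `∂ₜρ + u·∇ρ + ρ div u = 0`,
  `ρ(∂ₜu + (u·∇)u) + ∇p = 0`, `(3/2)ρ(∂ₜθ + u·∇θ) + p div u = 0` pointwise on `[0, T) × 𝕋³`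
  solve the conservation form `IsHardSphereEulerSolution` (`IsHardSphereEulerSolution.of_primitive`:
  product rules of the torus calculus for `∂ₜ(ρu)`, `∑ᵢ∂ᵢ(ρuᵢu)`, `∂ₜE`, `div((E + p)u)`);
  (5b) fields with packing in `(0, η₀)` satisfying the rows of the SYMMETRISED system
  `A⁰(V)∂ₜV + ∑ⱼAⱼ(V)∂ⱼV = 0`, `V = (ρ, u, θ)`, `A⁰ = diag(p_ρ/ρ, ρ, ρ, ρ, 3ρ/(2θ))` — the form
  in which Thm 5.1.1 / Majda Thm 2.1 produces the solution — satisfy the primitive equations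
  (`IsHardSphereEulerSolution.of_symmetricForm`; chain rule `∂ₖ[p(ρ,θ)] = p_ρ∂ₖρ + p_θ∂ₖθ`,
  `partialDeriv_hsPressure`, and `θ p_θ = p`, `deriv_hsPressure_temperature_mul`);
  (5c) the packing of a jointly smooth density with initial packing `≤ η₁ < η₀` stays `< η₀` on
  a short time interval, uniformly on the compact torus (`exists_time_packing_lt`).
  What remains OPEN is exactly Steps 1–4: the general local existence theorem for smooth
  symmetric hyperbolic quasilinear systems on `𝕋³` with `C^∞` data (values in a compact subset
  of the state domain) and jointly `C^∞` solutions on some `[0, T)`.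

Everything below is proved; no named fact and no `sorry` is introduced.

## Mathlib / tree search

Mathlib: `AnalyticOnNhd.deriv`, `AnalyticAt.congr`, `Filter.EventuallyEq.deriv_eq`,
`AnalyticAt.fun_mul`, `AnalyticAt.fun_comp_of_eq`, `AnalyticOnNhd.contDiffOn_of_completeSpace`,
`ContinuousAt.eventually_lt`, `IsCompact.exists_isMinOn`. Tree: the definitions
`hsExcessFreeEnergy`, `hsCompressibility`, `hsPressure` (`HardSphereEuler.lean`); nothing on the
equation of state beyond `hsFreeVolume_le_one` (`lean search 'hsCompressibility|hsPressure'`);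
the torus calculus `Torus.divergence_smul`, `Torus.partialDeriv_smul/_mul/_add`,
`Torus.partialDeriv_comp₂`, `Torus.isContDiff_comp₂`, `Torus.partialDeriv_half_norm_sq`,
`Torus.gradient_apply`, `Torus.partialDeriv_apply_coord` (`TorusCalculusProofs`, `TorusChainRule`,
`TorusTestFunction`, `TorusMollifierEstimates`, `TorusEnstrophyOrthogonality`), the one-sided time
product rules `CompressibleEuler.timeDerivWithin_smul/_mul/_add/_half_norm_sq`
(`FluidPDE/ClassicalEulerPointData`, written for the converse direction conservation ⇒ primitive
of the Březina–Feireisl system), and the tube lemma `IsSmoothSpaceTimeOn.eventually_norm_sub_lt`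
(`TorusSpaceTime`).

## References

* C. M. Dafermos, *Hyperbolic Conservation Laws in Continuum Physics*, 2nd ed., Grundlehren 325,
  Springer 2005: Ch. V, §5.1, Thm 5.1.1 and its proof sketch (5.1.5)–(5.1.25); §5.4 (notes:
  complete proof in Majda [3]; Kato [1], Taylor [1]). [`Dafermos2005`]
* A. Majda, *Compressible Fluid Flow and Systems of Conservation Laws in Several Space
  Variables*, Appl. Math. Sci. 53, Springer 1984: Ch. 1 (symmetrisation of the Euler system of
  gas dynamics), Ch. 2, §2.1, Thm 2.1–2.2. [`Majda1984`]
* M. E. Taylor, *Partial Differential Equations III*, 2nd ed., Springer 2011: Ch. 16, §§1–2,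
  §5. [`TaylorPDEIII2011`]
-/

noncomputable section

open Set Filter Topology
open scoped ContDiff

namespace Literature.MathematicalPhysics.KineticTheory

open Literature.Analysis.FunctionSpaces Literature.Analysis.FunctionSpaces.Torus
open Literature.Analysis.FluidPDE

/-! ### Step 0a. The compressibility factor under the equation-of-state hypothesis -/

section EquationOfState

variable {η₀ : ℝ} {F : ℝ → ℝ}

/-- Under the equation-of-state hypothesis `f_ex = F` on `[0, η₀)`, the excess free energy agrees
with `F` near every packing fraction of the OPEN interval `(0, η₀)`. [folklore] -/
theorem hsExcessFreeEnergy_eventuallyEq (hF : EqOn hsExcessFreeEnergy F (Ico 0 η₀)) {η : ℝ}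
    (hη : η ∈ Ioo 0 η₀) : hsExcessFreeEnergy =ᶠ[𝓝 η] F :=
  (hF.mono Ioo_subset_Ico_self).eventuallyEq_of_mem (isOpen_Ioo.mem_nhds hη)

/-- Hence the derivatives agree on `(0, η₀)`: `f_ex'(η) = F'(η)` (the junk value of `deriv` is
never met there). [folklore] -/
theorem deriv_hsExcessFreeEnergy_eq (hF : EqOn hsExcessFreeEnergy F (Ico 0 η₀)) {η : ℝ}
    (hη : η ∈ Ioo 0 η₀) : deriv hsExcessFreeEnergy η = deriv F η :=
  (hsExcessFreeEnergy_eventuallyEq hF hη).deriv_eq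

/-- **The compressibility factor at small packing**: `Z(η) = 1 + η F'(η)` for `0 < η < η₀`
(virial form of the equation of state, `βP/ρ = 1 + η ∂_η(βf_ex)`).
[cite: Dafermos2005, Thm 5.1.1] -/
theorem hsCompressibility_eq (hF : EqOn hsExcessFreeEnergy F (Ico 0 η₀)) {η : ℝ}
    (hη : η ∈ Ioo 0 η₀) : hsCompressibility η = 1 + η * deriv F η := by
  rw [hsCompressibility, deriv_hsExcessFreeEnergy_eq hF hη]

/-- **`Z` is real analytic on `(0, η₀)`** when `F` is analytic on `(-η₀, η₀)` (so the fluxes of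
the hard-sphere Euler system are real analytic on the state domain; Thm 5.1.1 only needs smooth
fluxes). [cite: Dafermos2005, Thm 5.1.1] -/
theorem analyticOnNhd_hsCompressibility (hFa : AnalyticOnNhd ℝ F (Ioo (-η₀) η₀))
    (hF : EqOn hsExcessFreeEnergy F (Ico 0 η₀)) :
    AnalyticOnNhd ℝ hsCompressibility (Ioo 0 η₀) := by
  intro η hη
  have hmem : η ∈ Ioo (-η₀) η₀ := ⟨by linarith [hη.1, hη.2], hη.2⟩
  have han : AnalyticAt ℝ (fun y => 1 + y * deriv F y) η :=
    analyticAt_const.fun_add (analyticAt_id.fun_mul (hFa.deriv η hmem))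
  refine han.congr ?_
  filter_upwards [isOpen_Ioo.mem_nhds hη] with y hy
  exact (hsCompressibility_eq hF hy).symm

/-! ### Step 0b. The packing threshold `η_c(η₀, F)` -/

/-- **The packing threshold.** If `F` is analytic on `(-η₀, η₀)`, `η₀ > 0`, then the continuous
function `g(η) = 1 + 2ηF'(η) + η²F''(η) = (Z + ηZ')(η)`, equal to `1` at `η = 0`, stays `≥ 1/2`
on a symmetric interval `[-η_c, η_c]` with `0 < η_c < η₀`; `η_c` depends only on `(η₀, F)` — this
is where the threshold `η₁`, quantified before `σ` in `hsEuler_localExistence`, comes from.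
[cite: Dafermos2005, Thm 5.1.1] -/
theorem exists_packing_threshold (hη₀ : 0 < η₀) (hFa : AnalyticOnNhd ℝ F (Ioo (-η₀) η₀)) :
    ∃ η_c : ℝ, 0 < η_c ∧ η_c < η₀ ∧ ∀ η ∈ Icc (-η_c) η_c,
      1 / 2 ≤ 1 + 2 * η * deriv F η + η ^ 2 * deriv (deriv F) η := by
  have h0 : (0 : ℝ) ∈ Ioo (-η₀) η₀ := ⟨by linarith, hη₀⟩
  have hc : ContinuousAt (fun η => 1 + 2 * η * deriv F η + η ^ 2 * deriv (deriv F) η) 0 := by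
    have h1 : ContinuousAt (deriv F) 0 := (hFa.deriv 0 h0).continuousAt
    have h2 : ContinuousAt (deriv (deriv F)) 0 := (hFa.deriv.deriv 0 h0).continuousAt
    exact (continuousAt_const.add ((continuousAt_const.mul continuousAt_id).mul h1)).add
      ((continuousAt_id.pow 2).mul h2)
  have hlt : (fun _ : ℝ => (1 / 2 : ℝ)) 0 <
      (fun η => 1 + 2 * η * deriv F η + η ^ 2 * deriv (deriv F) η) 0 := by norm_num
  have hev := continuousAt_const.eventually_lt hc hlt
  obtain ⟨ε, hε, hball⟩ := Metric.eventually_nhds_iff.1 hev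
  refine ⟨min (ε / 2) (η₀ / 2), by positivity, by
    calc min (ε / 2) (η₀ / 2) ≤ η₀ / 2 := min_le_right _ _
      _ < η₀ := by linarith, fun η hη => ?_⟩
  have hdist : dist η 0 < ε := by
    rw [Real.dist_eq, sub_zero, abs_lt]
    constructor
    · calc -ε < -(ε / 2) := by linarith
        _ ≤ -min (ε / 2) (η₀ / 2) := by linarith [min_le_left (ε / 2) (η₀ / 2)]
        _ ≤ η := hη.1
    · calc η ≤ min (ε / 2) (η₀ / 2) := hη.2
        _ ≤ ε / 2 := min_le_left _ _
        _ < ε := by linarith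
  exact (hball hdist).le

/-! ### Step 0c. The pressure law: smoothness and `∂p/∂ρ > 0` at small packing -/

variable {σ : ℝ}

/-- Near a state whose packing `ρσ³` lies in `(0, η₀)` the pressure law is the analytic law
`p(r, θ) = rθ(1 + rσ³F'(rσ³))` (as a function of the density, at fixed temperature). [folklore] -/
theorem hsPressure_eventuallyEq (hF : EqOn hsExcessFreeEnergy F (Ico 0 η₀)) (θ : ℝ) {ρ : ℝ}
    (hρ : ρ * σ ^ 3 ∈ Ioo 0 η₀) :
    (fun r => hsPressure σ r θ) =ᶠ[𝓝 ρ]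
      fun r => r * θ * (1 + r * σ ^ 3 * deriv F (r * σ ^ 3)) := by
  have hopen : IsOpen {r : ℝ | r * σ ^ 3 ∈ Ioo 0 η₀} :=
    isOpen_Ioo.preimage (continuous_id.mul continuous_const)
  filter_upwards [hopen.mem_nhds hρ] with r hr
  rw [hsPressure, hsCompressibility_eq hF hr]

/-- **The isothermal sound speed squared**: `∂p/∂ρ (ρ, θ) = θ (Z + ηZ')(η) =
θ (1 + 2ηF'(η) + η²F''(η))`, `η = ρσ³ ∈ (0, η₀)` (chain and product rules; `F'` is differentiable
because `F` is analytic). [cite: Dafermos2005, Thm 5.1.1] -/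
theorem hasDerivAt_hsPressure_density (hFa : AnalyticOnNhd ℝ F (Ioo (-η₀) η₀))
    (hF : EqOn hsExcessFreeEnergy F (Ico 0 η₀)) (θ : ℝ) {ρ : ℝ} (hρ : ρ * σ ^ 3 ∈ Ioo 0 η₀) :
    HasDerivAt (fun r => hsPressure σ r θ)
      (θ * (1 + 2 * (ρ * σ ^ 3) * deriv F (ρ * σ ^ 3) +
        (ρ * σ ^ 3) ^ 2 * deriv (deriv F) (ρ * σ ^ 3))) ρ := by
  have hmem : ρ * σ ^ 3 ∈ Ioo (-η₀) η₀ := ⟨by linarith [hρ.1, hρ.2], hρ.2⟩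
  have hF' : HasDerivAt (deriv F) (deriv (deriv F) (ρ * σ ^ 3)) (ρ * σ ^ 3) :=
    (hFa.deriv _ hmem).differentiableAt.hasDerivAt
  have hlin : HasDerivAt (fun r : ℝ => r * σ ^ 3) (σ ^ 3) ρ := by
    simpa using (hasDerivAt_id ρ).mul_const (σ ^ 3)
  have hcomp : HasDerivAt (fun r : ℝ => deriv F (r * σ ^ 3))
      (deriv (deriv F) (ρ * σ ^ 3) * σ ^ 3) ρ := by
    have h := hF'.comp ρ hlin
    simpa [Function.comp_def] using h
  have hG : HasDerivAt (fun r : ℝ => 1 + r * σ ^ 3 * deriv F (r * σ ^ 3))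
      (0 + (σ ^ 3 * deriv F (ρ * σ ^ 3) +
        ρ * σ ^ 3 * (deriv (deriv F) (ρ * σ ^ 3) * σ ^ 3))) ρ :=
    (hasDerivAt_const ρ (1 : ℝ)).add (hlin.mul hcomp)
  have hrθ : HasDerivAt (fun r : ℝ => r * θ) θ ρ := by
    simpa using (hasDerivAt_id ρ).mul_const θ
  refine ((hrθ.mul hG).congr_of_eventuallyEq (hsPressure_eventuallyEq hF θ hρ)).congr_deriv ?_
  ring

/-- **Hyperbolicity / symmetrisability at small packing**: if `1 + 2ηF' + η²F'' ≥ 1/2` on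
`[-η_c, η_c]` (the threshold of `exists_packing_threshold`) then `∂p/∂ρ ≥ θ/2` at every state with
`θ > 0` and packing `0 < ρσ³ ≤ η_c`, `ρσ³ < η₀` — the `(ρ, ρ)` entry `p_ρ/ρ` of the Friedrichs
symmetriser `diag(p_ρ/ρ, ρ, ρ, ρ, 3ρ/(2θ))` is then positive. [cite: Dafermos2005, Thm 5.1.1] -/
theorem deriv_hsPressure_density_ge (hFa : AnalyticOnNhd ℝ F (Ioo (-η₀) η₀))
    (hF : EqOn hsExcessFreeEnergy F (Ico 0 η₀)) {η_c : ℝ}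
    (hc : ∀ η ∈ Icc (-η_c) η_c, 1 / 2 ≤ 1 + 2 * η * deriv F η + η ^ 2 * deriv (deriv F) η)
    {θ ρ : ℝ} (hθ : 0 < θ) (hρ : ρ * σ ^ 3 ∈ Ioo 0 η₀) (hρc : ρ * σ ^ 3 ≤ η_c) :
    θ / 2 ≤ deriv (fun r => hsPressure σ r θ) ρ := by
  rw [(hasDerivAt_hsPressure_density hFa hF θ hρ).deriv]
  have h := hc (ρ * σ ^ 3) ⟨by linarith [hρ.1], hρc⟩
  nlinarith

/-- **The threshold of the fact, assembled**: under the equation-of-state hypothesis of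
`hsEuler_localExistence` there is `η₁ > 0` with `2η₁ < η₀`, depending only on `(η₀, F)`, such that
for EVERY reduced diameter `σ`, every temperature `θ > 0` and every density with packing
`0 < ρσ³ ≤ 2η₁` one has `∂p/∂ρ ≥ θ/2 > 0` (so data with packing `≤ η₁` sit, with room to spare,
inside the region where the hard-sphere Euler system is symmetrisable hyperbolic).
[cite: Dafermos2005, Thm 5.1.1] -/
theorem exists_threshold_deriv_hsPressure_density_ge (hη₀ : 0 < η₀)
    (hFa : AnalyticOnNhd ℝ F (Ioo (-η₀) η₀)) (hF : EqOn hsExcessFreeEnergy F (Ico 0 η₀)) :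
    ∃ η₁ : ℝ, 0 < η₁ ∧ 2 * η₁ < η₀ ∧ ∀ σ θ ρ : ℝ, 0 < θ → 0 < ρ * σ ^ 3 → ρ * σ ^ 3 ≤ 2 * η₁ →
      θ / 2 ≤ deriv (fun r => hsPressure σ r θ) ρ := by
  obtain ⟨η_c, hc0, hcη₀, hc⟩ := exists_packing_threshold hη₀ hFa
  refine ⟨η_c / 2, by positivity, by linarith, fun σ θ ρ hθ hρ0 hρ1 => ?_⟩
  exact deriv_hsPressure_density_ge hFa hF hc hθ ⟨hρ0, by linarith⟩ (by linarith)

/-- **The pressure law is jointly real analytic in `(ρ, θ)`** on the open state set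
`{(ρ, θ) | 0 < ρσ³ < η₀}` (as `(ρ, θ) ↦ ρ θ Z(ρσ³)` with `Z` analytic on `(0, η₀)`).
[cite: Dafermos2005, Thm 5.1.1] -/
theorem analyticOnNhd_hsPressure (hFa : AnalyticOnNhd ℝ F (Ioo (-η₀) η₀))
    (hF : EqOn hsExcessFreeEnergy F (Ico 0 η₀)) (σ : ℝ) :
    AnalyticOnNhd ℝ (fun q : ℝ × ℝ => hsPressure σ q.1 q.2) {q | q.1 * σ ^ 3 ∈ Ioo 0 η₀} := by
  intro q hq
  have hZ : AnalyticAt ℝ hsCompressibility (q.1 * σ ^ 3) :=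
    analyticOnNhd_hsCompressibility hFa hF _ hq
  have hlin : AnalyticAt ℝ (fun q : ℝ × ℝ => q.1 * σ ^ 3) q := analyticAt_fst.fun_mul analyticAt_const
  have hcomp : AnalyticAt ℝ (fun q : ℝ × ℝ => hsCompressibility (q.1 * σ ^ 3)) q :=
    hZ.fun_comp_of_eq hlin rfl
  have h : AnalyticAt ℝ (fun q : ℝ × ℝ => q.1 * q.2 * hsCompressibility (q.1 * σ ^ 3)) q :=
    (analyticAt_fst.fun_mul analyticAt_snd).fun_mul hcomp
  simpa only [hsPressure] using h

/-- **The pressure law is jointly `C^∞` in `(ρ, θ)`** on `{0 < ρσ³ < η₀}` — the smoothness of the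
fluxes `G_α` required by Thm 5.1.1 (the other constitutive functions, `ρu ⊗ u` and
`E = ρ(|u|²/2 + 3θ/2)`, are polynomial). [cite: Dafermos2005, Thm 5.1.1] -/
theorem contDiffOn_hsPressure (hFa : AnalyticOnNhd ℝ F (Ioo (-η₀) η₀))
    (hF : EqOn hsExcessFreeEnergy F (Ico 0 η₀)) (σ : ℝ) :
    ContDiffOn ℝ ∞ (fun q : ℝ × ℝ => hsPressure σ q.1 q.2) {q | q.1 * σ ^ 3 ∈ Ioo 0 η₀} :=
  (analyticOnNhd_hsPressure hFa hF σ).contDiffOn_of_completeSpace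

end EquationOfState

/-! ### Step 0d. Data on the compact torus take values in a compact subset of the state domain -/

section Data

/-- A continuous positive function on `𝕋³` is pinched between two positive constants
(compactness of the torus): smooth data `ρ₀, θ₀ > 0` of `hsEuler_localExistence` take values in
a compact subset `[m, M]² × B̄(0, M)` of the state domain, as Thm 5.1.1 requires.
[cite: Dafermos2005, Thm 5.1.1] -/
theorem exists_pos_le_le_of_continuous {f : T3 → ℝ} (hf : Continuous f) (hpos : ∀ x, 0 < f x) :
    ∃ m M : ℝ, 0 < m ∧ m ≤ M ∧ ∀ x, m ≤ f x ∧ f x ≤ M := by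
  obtain ⟨x₀, -, hx₀⟩ := isCompact_univ.exists_isMinOn univ_nonempty hf.continuousOn
  obtain ⟨x₁, -, hx₁⟩ := isCompact_univ.exists_isMaxOn univ_nonempty hf.continuousOn
  exact ⟨f x₀, f x₁, hpos x₀, hx₁ (mem_univ x₀),
    fun x => ⟨hx₀ (mem_univ x), hx₁ (mem_univ x)⟩⟩

/-- The norm of a continuous vector field on `𝕋³` is bounded. [folklore] -/
theorem exists_norm_le_of_continuous {u : T3 → V3} (hu : Continuous u) :
    ∃ M : ℝ, 0 ≤ M ∧ ∀ x, ‖u x‖ ≤ M := by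
  obtain ⟨x₁, -, hx₁⟩ :=
    isCompact_univ.exists_isMaxOn univ_nonempty (continuous_norm.comp hu).continuousOn
  exact ⟨‖u x₁‖, norm_nonneg _, fun x => hx₁ (mem_univ x)⟩

end Data

/-! ### Step 5a: the primitive (convective) form implies the conservation form -/

section Primitive

variable {σ T : ℝ} {ρ θ : ℝ → T3 → ℝ} {u : ℝ → T3 → V3}

/-- **Step 5a: the primitive (convective) form implies the conservation form.** Jointly smooth
fields `(ρ, u, θ)` on `[0, T) × 𝕋³` with `ρ, θ > 0` and `C¹` pressure slices which satisfy,
pointwise with the one-sided time derivative within `[0, T)`, `∂ₜρ + u·∇ρ + ρ div u = 0`,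
`ρ(∂ₜu + ∑ᵢuᵢ∂ᵢu) + ∇p = 0` and `(3/2)ρ(∂ₜθ + u·∇θ) + p div u = 0`, `p = hsPressure σ ρ θ`,
form a classical hard-sphere Euler solution `IsHardSphereEulerSolution σ T ρ u θ`
(`∂ₜ(ρu) = ρ∂ₜu + (∂ₜρ)u`, `∑ᵢ∂ᵢ(ρuᵢu) = ∑ᵢρuᵢ∂ᵢu + div(ρu) u`, `∂ₜE = (∂ₜρ)(|u|²/2 + 3θ/2) +
ρ(∑ₖuₖ∂ₜuₖ + (3/2)∂ₜθ)`, `div((E+p)u) = (E+p) div u + u·∇(E+p)`; for classical solutions the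
two forms are equivalent, Dafermos §3.3 / Majda Ch. 1). [cite: Dafermos2005, Thm 5.1.1] -/
theorem IsHardSphereEulerSolution.of_primitive
    (hρ : IsSmoothSpaceTimeOn (Ico 0 T) ρ) (hu : IsSmoothSpaceTimeOn (Ico 0 T) u)
    (hθ : IsSmoothSpaceTimeOn (Ico 0 T) θ)
    (hρpos : ∀ t ∈ Ico 0 T, ∀ x, 0 < ρ t x) (hθpos : ∀ t ∈ Ico 0 T, ∀ x, 0 < θ t x)
    (hp : ∀ t ∈ Ico 0 T, IsContDiff 1 fun y => hsPressure σ (ρ t y) (θ t y))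
    (mass' : ∀ t ∈ Ico 0 T, ∀ x,
      timeDerivWithin (Ico 0 T) ρ t x + ∑ i, u t x i * partialDeriv i (ρ t) x +
        ρ t x * divergence (u t) x = 0)
    (mom' : ∀ t ∈ Ico 0 T, ∀ x,
      ρ t x • (timeDerivWithin (Ico 0 T) u t x + ∑ i, u t x i • partialDeriv i (u t) x) +
        Torus.gradient (fun y => hsPressure σ (ρ t y) (θ t y)) x = 0)
    (temp' : ∀ t ∈ Ico 0 T, ∀ x,
      3 / 2 * ρ t x * (timeDerivWithin (Ico 0 T) θ t x + ∑ i, u t x i * partialDeriv i (θ t) x) +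
        hsPressure σ (ρ t x) (θ t x) * divergence (u t) x = 0) :
    IsHardSphereEulerSolution σ T ρ u θ := by
  have hS : UniqueDiffOn ℝ (Ico 0 T) := uniqueDiffOn_Ico 0 T
  -- slices are `C¹`
  have hρ1 : ∀ {t}, t ∈ Ico 0 T → IsContDiff 1 (ρ t) := fun ht =>
    (hρ.isSmooth_slice ht).isContDiff (by simp)
  have hu1 : ∀ {t}, t ∈ Ico 0 T → IsContDiff 1 (u t) := fun ht =>
    (hu.isSmooth_slice ht).isContDiff (by simp)
  have hθ1 : ∀ {t}, t ∈ Ico 0 T → IsContDiff 1 (θ t) := fun ht =>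
    (hθ.isSmooth_slice ht).isContDiff (by simp)
  have hui1 : ∀ {t}, t ∈ Ico 0 T → ∀ i, IsContDiff 1 (fun y => u t y i) := fun ht i =>
    (EuclideanSpace.proj i : V3 →L[ℝ] ℝ).contDiff.comp (hu1 ht)
  -- the mass equation in conservation form
  have hmass : ∀ t ∈ Ico 0 T, ∀ x,
      timeDerivWithin (Ico 0 T) ρ t x + divergence (fun y => ρ t y • u t y) x = 0 := by
    intro t ht x
    rw [divergence_smul (hρ1 ht) (hu1 ht)]
    have h := mass' t ht x
    linarith
  refine ⟨hρ, hu, hθ, hρpos, hθpos, hmass, ?_, ?_⟩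
  · -- momentum
    intro t ht x
    have hdt : timeDerivWithin (Ico 0 T) (fun s y => ρ s y • u s y) t x =
        ρ t x • timeDerivWithin (Ico 0 T) u t x + timeDerivWithin (Ico 0 T) ρ t x • u t x :=
      CompressibleEuler.timeDerivWithin_smul hρ hu hS ht x
    have hρui : ∀ i, IsContDiff 1 (fun y => ρ t y * u t y i) := fun i =>
      ContDiff.mul (hρ1 ht) (hui1 ht i)
    have hflux : ∀ i, partialDeriv i (fun y => (ρ t y * u t y i) • u t y) x =
        (ρ t x * u t x i) • partialDeriv i (u t) x +
          partialDeriv i (fun y => ρ t y * u t y i) x • u t x := fun i =>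
      partialDeriv_smul (hρui i) (hu1 ht) i x
    have hdiv : divergence (fun y => ρ t y • u t y) x =
        ∑ i, partialDeriv i (fun y => ρ t y * u t y i) x := by
      unfold divergence
      refine Finset.sum_congr rfl fun i _ => ?_
      congr 1
    have key : timeDerivWithin (Ico 0 T) (fun s y => ρ s y • u s y) t x +
        (∑ i, partialDeriv i (fun y => (ρ t y * u t y i) • u t y) x) +
        Torus.gradient (fun y => hsPressure σ (ρ t y) (θ t y)) x =
        (ρ t x • (timeDerivWithin (Ico 0 T) u t x + ∑ i, u t x i • partialDeriv i (u t) x) +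
          Torus.gradient (fun y => hsPressure σ (ρ t y) (θ t y)) x) +
        (timeDerivWithin (Ico 0 T) ρ t x + divergence (fun y => ρ t y • u t y) x) • u t x := by
      rw [hdt, Finset.sum_congr rfl fun i _ => hflux i, Finset.sum_add_distrib, hdiv,
        ← Finset.sum_smul, smul_add, Finset.smul_sum, add_smul]
      simp only [smul_smul]
      abel
    rw [key, mom' t ht x, hmass t ht x, zero_smul, add_zero]
  · -- energy
    intro t ht x
    -- the specific non-density factor `B = |u|²/2 + 3θ/2` and the pressure slice `P`
    set B : ℝ → T3 → ℝ := fun s y => ‖u s y‖ ^ 2 / 2 + 3 / 2 * θ s y with hBdef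
    have hK : IsSmoothSpaceTimeOn (Ico 0 T) (fun s y => ‖u s y‖ ^ 2 / 2) :=
      (ContDiffOn.norm_sq ℝ hu).div_const 2
    have h32 : IsSmoothSpaceTimeOn (Ico 0 T) (fun s y => 3 / 2 * θ s y) :=
      contDiffOn_const.mul hθ
    have hB : IsSmoothSpaceTimeOn (Ico 0 T) B := hK.add h32
    have hB1 : IsContDiff 1 (B t) := (hB.isSmooth_slice ht).isContDiff (by simp)
    have hK1 : IsContDiff 1 (fun y => ‖u t y‖ ^ 2 / 2) := (hK.isSmooth_slice ht).isContDiff (by simp)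
    have h321 : IsContDiff 1 (fun y => 3 / 2 * θ t y) := (h32.isSmooth_slice ht).isContDiff (by simp)
    have hE1 : IsContDiff 1 (fun y => ρ t y * B t y) := ContDiff.mul (hρ1 ht) hB1
    have hP1 : IsContDiff 1 (fun y => hsPressure σ (ρ t y) (θ t y)) := hp t ht
    have hEP1 : IsContDiff 1 (fun y => ρ t y * B t y + hsPressure σ (ρ t y) (θ t y)) :=
      ContDiff.add hE1 hP1
    -- time derivative of the energy density
    have hdtE : timeDerivWithin (Ico 0 T) (fun s y => totalEnergyDensity (ρ s y) (u s y) (θ s y)) t x =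
        timeDerivWithin (Ico 0 T) ρ t x * B t x + ρ t x * timeDerivWithin (Ico 0 T) B t x :=
      CompressibleEuler.timeDerivWithin_mul hρ hB hS ht x
    have hdt32 : timeDerivWithin (Ico 0 T) (fun s y => 3 / 2 * θ s y) t x =
        3 / 2 * timeDerivWithin (Ico 0 T) θ t x :=
      ((hθ.hasDerivWithinAt_slice ht x).const_mul (3 / 2)).derivWithin (hS t ht)
    have hdtB : timeDerivWithin (Ico 0 T) B t x =
        (∑ k, u t x k * timeDerivWithin (Ico 0 T) u t x k) + 3 / 2 * timeDerivWithin (Ico 0 T) θ t x := by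
      rw [hBdef, CompressibleEuler.timeDerivWithin_add hK h32 hS ht x,
        CompressibleEuler.timeDerivWithin_half_norm_sq hu hS ht x, hdt32]
    -- spatial derivatives
    have hdivE : divergence (fun y => (totalEnergyDensity (ρ t y) (u t y) (θ t y) +
        hsPressure σ (ρ t y) (θ t y)) • u t y) x =
        (ρ t x * B t x + hsPressure σ (ρ t x) (θ t x)) * divergence (u t) x +
          ∑ i, u t x i * partialDeriv i (fun y => ρ t y * B t y + hsPressure σ (ρ t y) (θ t y)) x :=
      divergence_smul hEP1 (hu1 ht) x
    have hdEP : ∀ i, partialDeriv i (fun y => ρ t y * B t y + hsPressure σ (ρ t y) (θ t y)) x =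
        partialDeriv i (fun y => ρ t y * B t y) x +
          partialDeriv i (fun y => hsPressure σ (ρ t y) (θ t y)) x := fun i =>
      congr_fun (partialDeriv_add hE1 hP1 i) x
    have hdE : ∀ i, partialDeriv i (fun y => ρ t y * B t y) x =
        ρ t x * partialDeriv i (B t) x + partialDeriv i (ρ t) x * B t x := fun i =>
      partialDeriv_mul (hρ1 ht) hB1 i x
    have hd32 : ∀ i, partialDeriv i (fun y => 3 / 2 * θ t y) x = 3 / 2 * partialDeriv i (θ t) x := by
      intro i
      rw [partialDeriv_mul (isContDiff_const _) (hθ1 ht) i x]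
      have h0 : partialDeriv i (fun _ : T3 => (3 / 2 : ℝ)) x = 0 := by
        simp [partialDeriv, Torus.lineDeriv]
      rw [h0]
      ring
    have hdB : ∀ i, partialDeriv i (B t) x =
        (∑ k, u t x k * partialDeriv i (u t) x k) + 3 / 2 * partialDeriv i (θ t) x := by
      intro i
      have h1 : partialDeriv i (B t) x =
          partialDeriv i (fun y => ‖u t y‖ ^ 2 / 2) x + partialDeriv i (fun y => 3 / 2 * θ t y) x :=
        congr_fun (partialDeriv_add hK1 h321 i) x
      rw [h1, partialDeriv_half_norm_sq (hu1 ht) i x, hd32 i]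
      congr 1
      refine Finset.sum_congr rfl fun k _ => ?_
      rw [partialDeriv_apply_coord (hu1 ht) i x k]
    have hdP : ∀ i, partialDeriv i (fun y => hsPressure σ (ρ t y) (θ t y)) x =
        Torus.gradient (fun y => hsPressure σ (ρ t y) (θ t y)) x i := fun i =>
      (gradient_apply hP1 x i).symm
    -- coordinates of the momentum equation
    have hmomk : ∀ k, ρ t x * timeDerivWithin (Ico 0 T) u t x k +
        ρ t x * (∑ i, u t x i * partialDeriv i (u t) x k) +
          Torus.gradient (fun y => hsPressure σ (ρ t y) (θ t y)) x k = 0 := by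
      intro k
      have h := congrArg (fun v : V3 => v k) (mom' t ht x)
      simpa using h
    -- assemble
    rw [hdtE, hdtB, hdivE]
    simp only [hdEP, hdE, hdB, hdP]
    have hm := mass' t ht x
    have hT := temp' t ht x
    have hm0 := hmomk 0
    have hm1 := hmomk 1
    have hm2 := hmomk 2
    simp only [Fin.sum_univ_three] at hm hT hm0 hm1 hm2 ⊢
    -- `totalEnergyDensity = ρ * B` pointwise
    have hEB : totalEnergyDensity (ρ t x) (u t x) (θ t x) = ρ t x * B t x := rfl
    linear_combination B t x * hm + u t x 0 * hm0 + u t x 1 * hm1 + u t x 2 * hm2 + hT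

end Primitive

/-! ### Step 5b: the symmetric form implies the primitive form -/

section Symmetric

variable {η₀ : ℝ} {F : ℝ → ℝ} {σ T : ℝ} {ρ θ : ℝ → T3 → ℝ} {u : ℝ → T3 → V3}

/-- `∂p/∂θ = ρ Z(ρσ³)`: the pressure law is linear in the temperature. [folklore] -/
theorem hasDerivAt_hsPressure_temperature (σ ρ θ : ℝ) :
    HasDerivAt (fun s => hsPressure σ ρ s) (ρ * hsCompressibility (ρ * σ ^ 3)) θ := by
  have h := ((hasDerivAt_id θ).const_mul ρ).mul_const (hsCompressibility (ρ * σ ^ 3))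
  simpa [hsPressure] using h

/-- `θ ∂p/∂θ = p`. [folklore] -/
theorem deriv_hsPressure_temperature_mul (σ ρ θ : ℝ) :
    θ * deriv (fun s => hsPressure σ ρ s) θ = hsPressure σ ρ θ := by
  rw [(hasDerivAt_hsPressure_temperature σ ρ θ).deriv, hsPressure]
  ring

/-- Spatial slices of the pressure field of smooth positive fields with packing in `(0, η₀)` are
`C¹`, under the equation-of-state hypothesis. [folklore] -/
theorem isContDiff_hsPressure_slice (hFa : AnalyticOnNhd ℝ F (Ioo (-η₀) η₀))
    (hF : EqOn hsExcessFreeEnergy F (Ico 0 η₀)) {a b : T3 → ℝ} (ha : IsContDiff 1 a)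
    (hb : IsContDiff 1 b) (hU : ∀ x, a x * σ ^ 3 ∈ Ioo 0 η₀) :
    IsContDiff 1 fun y => hsPressure σ (a y) (b y) := by
  have hg : ContDiffOn ℝ ∞ (Function.uncurry (hsPressure σ)) {q : ℝ × ℝ | q.1 * σ ^ 3 ∈ Ioo 0 η₀} :=
    contDiffOn_hsPressure hFa hF σ
  exact isContDiff_comp₂ hg (by simp) ha hb fun x => hU x

/-- **Chain rule for the pressure gradient**: `∂ₖ[p(ρ, θ)] = p_ρ ∂ₖρ + p_θ ∂ₖθ` for `C¹` fields
with packing in `(0, η₀)`. [folklore] -/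
theorem partialDeriv_hsPressure (hFa : AnalyticOnNhd ℝ F (Ioo (-η₀) η₀))
    (hF : EqOn hsExcessFreeEnergy F (Ico 0 η₀)) {a b : T3 → ℝ} (ha : IsContDiff 1 a)
    (hb : IsContDiff 1 b) (x : T3) (hx : a x * σ ^ 3 ∈ Ioo 0 η₀) (k : Fin 3) :
    partialDeriv k (fun y => hsPressure σ (a y) (b y)) x =
      deriv (fun r => hsPressure σ r (b x)) (a x) * partialDeriv k a x +
        deriv (fun s => hsPressure σ (a x) s) (b x) * partialDeriv k b x := by
  have hg : ContDiffOn ℝ ∞ (Function.uncurry (hsPressure σ)) {q : ℝ × ℝ | q.1 * σ ^ 3 ∈ Ioo 0 η₀} :=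
    contDiffOn_hsPressure hFa hF σ
  have hopen : IsOpen {q : ℝ × ℝ | q.1 * σ ^ 3 ∈ Ioo 0 η₀} :=
    isOpen_Ioo.preimage (continuous_fst.mul continuous_const)
  exact partialDeriv_comp₂ hg hopen (by simp) ha hb x hx k

/-- **Step 5b+5a: the symmetrised form implies the conservation form.** If smooth positive
fields `(ρ, u, θ)` with packing `ρσ³ < η₀` satisfy, pointwise on `[0, T) × 𝕋³`, the rows of the
symmetric system `A⁰(V)∂ₜV + ∑ⱼ Aⱼ(V)∂ⱼV = 0`, `V = (ρ, u, θ)`,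
`A⁰ = diag(p_ρ/ρ, ρ, ρ, ρ, 3ρ/(2θ))` — namely
`(p_ρ/ρ)(∂ₜρ + u·∇ρ) + p_ρ div u = 0`, `ρ(∂ₜuₖ + u·∇uₖ) + p_ρ∂ₖρ + p_θ∂ₖθ = 0`,
`(3ρ/2θ)(∂ₜθ + u·∇θ) + p_θ div u = 0` with `p_ρ ≠ 0` — then `(ρ, u, θ)` is a classical
hard-sphere Euler solution. [cite: Dafermos2005, Thm 5.1.1] -/
theorem IsHardSphereEulerSolution.of_symmetricForm (hFa : AnalyticOnNhd ℝ F (Ioo (-η₀) η₀))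
    (hF : EqOn hsExcessFreeEnergy F (Ico 0 η₀))
    (hρ : IsSmoothSpaceTimeOn (Ico 0 T) ρ) (hu : IsSmoothSpaceTimeOn (Ico 0 T) u)
    (hθ : IsSmoothSpaceTimeOn (Ico 0 T) θ)
    (hρpos : ∀ t ∈ Ico 0 T, ∀ x, 0 < ρ t x) (hθpos : ∀ t ∈ Ico 0 T, ∀ x, 0 < θ t x)
    (hpack : ∀ t ∈ Ico 0 T, ∀ x, ρ t x * σ ^ 3 ∈ Ioo 0 η₀)
    (hpρ : ∀ t ∈ Ico 0 T, ∀ x, deriv (fun r => hsPressure σ r (θ t x)) (ρ t x) ≠ 0)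
    (row0 : ∀ t ∈ Ico 0 T, ∀ x,
      deriv (fun r => hsPressure σ r (θ t x)) (ρ t x) / ρ t x *
          (timeDerivWithin (Ico 0 T) ρ t x + ∑ i, u t x i * partialDeriv i (ρ t) x) +
        deriv (fun r => hsPressure σ r (θ t x)) (ρ t x) * divergence (u t) x = 0)
    (rowu : ∀ t ∈ Ico 0 T, ∀ x, ∀ k,
      ρ t x * (timeDerivWithin (Ico 0 T) u t x k + ∑ i, u t x i * partialDeriv i (u t) x k) +
        deriv (fun r => hsPressure σ r (θ t x)) (ρ t x) * partialDeriv k (ρ t) x +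
        deriv (fun s => hsPressure σ (ρ t x) s) (θ t x) * partialDeriv k (θ t) x = 0)
    (row4 : ∀ t ∈ Ico 0 T, ∀ x,
      3 * ρ t x / (2 * θ t x) *
          (timeDerivWithin (Ico 0 T) θ t x + ∑ i, u t x i * partialDeriv i (θ t) x) +
        deriv (fun s => hsPressure σ (ρ t x) s) (θ t x) * divergence (u t) x = 0) :
    IsHardSphereEulerSolution σ T ρ u θ := by
  have hρ1 : ∀ {t}, t ∈ Ico 0 T → IsContDiff 1 (ρ t) := fun ht =>
    (hρ.isSmooth_slice ht).isContDiff (by simp)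
  have hu1 : ∀ {t}, t ∈ Ico 0 T → IsContDiff 1 (u t) := fun ht =>
    (hu.isSmooth_slice ht).isContDiff (by simp)
  have hθ1 : ∀ {t}, t ∈ Ico 0 T → IsContDiff 1 (θ t) := fun ht =>
    (hθ.isSmooth_slice ht).isContDiff (by simp)
  have hp : ∀ t ∈ Ico 0 T, IsContDiff 1 fun y => hsPressure σ (ρ t y) (θ t y) := fun t ht =>
    isContDiff_hsPressure_slice hFa hF (hρ1 ht) (hθ1 ht) (hpack t ht)
  refine IsHardSphereEulerSolution.of_primitive hρ hu hθ hρpos hθpos hp ?_ ?_ ?_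
  · -- mass
    intro t ht x
    have h0 := row0 t ht x
    have hr : ρ t x ≠ 0 := (hρpos t ht x).ne'
    have hq : deriv (fun r => hsPressure σ r (θ t x)) (ρ t x) / ρ t x ≠ 0 :=
      div_ne_zero (hpρ t ht x) hr
    have h1 : deriv (fun r => hsPressure σ r (θ t x)) (ρ t x) / ρ t x *
        (timeDerivWithin (Ico 0 T) ρ t x + ∑ i, u t x i * partialDeriv i (ρ t) x +
          ρ t x * divergence (u t) x) = 0 := by
      have e : deriv (fun r => hsPressure σ r (θ t x)) (ρ t x) / ρ t x *
          (timeDerivWithin (Ico 0 T) ρ t x + ∑ i, u t x i * partialDeriv i (ρ t) x +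
            ρ t x * divergence (u t) x) =
          deriv (fun r => hsPressure σ r (θ t x)) (ρ t x) / ρ t x *
            (timeDerivWithin (Ico 0 T) ρ t x + ∑ i, u t x i * partialDeriv i (ρ t) x) +
          deriv (fun r => hsPressure σ r (θ t x)) (ρ t x) * divergence (u t) x := by
        field_simp
      rw [e]
      exact h0
    exact (mul_eq_zero.1 h1).resolve_left hq
  · -- momentum
    intro t ht x
    have hgrad : ∀ k, Torus.gradient (fun y => hsPressure σ (ρ t y) (θ t y)) x k =
        deriv (fun r => hsPressure σ r (θ t x)) (ρ t x) * partialDeriv k (ρ t) x +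
          deriv (fun s => hsPressure σ (ρ t x) s) (θ t x) * partialDeriv k (θ t) x := fun k => by
      rw [gradient_apply (hp t ht) x k]
      exact partialDeriv_hsPressure hFa hF (hρ1 ht) (hθ1 ht) x (hpack t ht x) k
    ext k
    have h := rowu t ht x k
    simp [hgrad]
    linear_combination h
  · -- temperature
    intro t ht x
    have h4 := row4 t ht x
    have hθne : θ t x ≠ 0 := (hθpos t ht x).ne'
    have hpθ := deriv_hsPressure_temperature_mul σ (ρ t x) (θ t x)
    have h1 : θ t x * (3 * ρ t x / (2 * θ t x) *
          (timeDerivWithin (Ico 0 T) θ t x + ∑ i, u t x i * partialDeriv i (θ t) x) +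
        deriv (fun s => hsPressure σ (ρ t x) s) (θ t x) * divergence (u t) x) = 0 := by
      rw [h4, mul_zero]
    have h2 : θ t x * (3 * ρ t x / (2 * θ t x)) = 3 / 2 * ρ t x := by
      field_simp
    have h3 : 3 / 2 * ρ t x *
          (timeDerivWithin (Ico 0 T) θ t x + ∑ i, u t x i * partialDeriv i (θ t) x) +
        θ t x * deriv (fun s => hsPressure σ (ρ t x) s) (θ t x) * divergence (u t) x = 0 := by
      have e : θ t x * (3 * ρ t x / (2 * θ t x) *
            (timeDerivWithin (Ico 0 T) θ t x + ∑ i, u t x i * partialDeriv i (θ t) x) +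
          deriv (fun s => hsPressure σ (ρ t x) s) (θ t x) * divergence (u t) x) =
          θ t x * (3 * ρ t x / (2 * θ t x)) *
            (timeDerivWithin (Ico 0 T) θ t x + ∑ i, u t x i * partialDeriv i (θ t) x) +
          θ t x * deriv (fun s => hsPressure σ (ρ t x) s) (θ t x) * divergence (u t) x := by
        ring
      rw [e, h2] at h1
      exact h1
    linear_combination h3 - divergence (u t) x * hpθ

end Symmetric

/-! ### Step 5c: the packing stays below `η₀` for a short time -/

section Packing

variable {T : ℝ} {ρ : ℝ → T3 → ℝ}

/-- **Packing persistence.** If `ρ` is jointly smooth on `[0, T) × 𝕋³`, `T > 0`, and the initial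
packing satisfies `ρ(0, ·)σ³ ≤ η₁ < η₀`, then `ρσ³ < η₀` on `[0, T') × 𝕋³` for some `0 < T' ≤ T`
(uniform-in-space continuity in time over the compact torus). [cite: Dafermos2005, Thm 5.1.1] -/
theorem exists_time_packing_lt (hρ : IsSmoothSpaceTimeOn (Ico 0 T) ρ) (hT : 0 < T) {σ η₁ η₀ : ℝ}
    (h0 : ∀ x, ρ 0 x * σ ^ 3 ≤ η₁) (hη : η₁ < η₀) :
    ∃ T' : ℝ, 0 < T' ∧ T' ≤ T ∧ ∀ t ∈ Ico 0 T', ∀ x, ρ t x * σ ^ 3 < η₀ := by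
  have h0S : (0 : ℝ) ∈ Ico 0 T := ⟨le_rfl, hT⟩
  set ε : ℝ := (η₀ - η₁) / (|σ ^ 3| + 1) with hε
  have hεpos : 0 < ε := div_pos (by linarith) (by positivity)
  have hεσ : ε * |σ ^ 3| < η₀ - η₁ := by
    rw [hε, div_mul_eq_mul_div, div_lt_iff₀ (by positivity)]
    nlinarith [abs_nonneg (σ ^ 3)]
  have hev := hρ.eventually_norm_sub_lt h0S hεpos
  rw [eventually_nhdsWithin_iff] at hev
  obtain ⟨δ, hδ, hball⟩ := Metric.eventually_nhds_iff.1 hev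
  refine ⟨min δ T, lt_min hδ hT, min_le_right _ _, fun t ht x => ?_⟩
  have htS : t ∈ Ico 0 T := ⟨ht.1, lt_of_lt_of_le ht.2 (min_le_right _ _)⟩
  have hdist : dist t 0 < δ := by
    rw [Real.dist_eq, sub_zero, abs_of_nonneg ht.1]
    exact lt_of_lt_of_le ht.2 (min_le_left _ _)
  have hlt : ‖ρ t x - ρ 0 x‖ < ε := hball hdist htS x
  rw [Real.norm_eq_abs] at hlt
  have h1 : ρ t x * σ ^ 3 ≤ ρ 0 x * σ ^ 3 + |ρ t x - ρ 0 x| * |σ ^ 3| := by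
    have : ρ t x * σ ^ 3 - ρ 0 x * σ ^ 3 = (ρ t x - ρ 0 x) * σ ^ 3 := by ring
    have h2 : (ρ t x - ρ 0 x) * σ ^ 3 ≤ |ρ t x - ρ 0 x| * |σ ^ 3| := by
      rw [← abs_mul]; exact le_abs_self _
    linarith
  have h3 : |ρ t x - ρ 0 x| * |σ ^ 3| ≤ ε * |σ ^ 3| :=
    mul_le_mul_of_nonneg_right hlt.le (abs_nonneg _)
  linarith [h0 x]

end Packing

end Literature.MathematicalPhysics.KineticTheory

end
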